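import Mathlib
import HarnessLib
import Summits.Ventures.LatticeQCDFlow.Scaling.ExactTransportOneSidedInstances

/-!
# LatticeQCDFlow / Scaling — the contraction law survives `ε`-accuracy: `log coLip ≥ c·log β - C` for EVERY
`ε`-accurate co-Lipschitz map, `ε ≤ 1/4`, uniformly in the volume

HONEST FRAMING: exact (Metropolis-corrected) sampling algorithms for lattice gauge theory; figures of merit are
autocorrelation/cost numbers at stated couplings and volumes; no continuum-physics claim.

Venture `LatticeQCDFlow` (cell pub-lqcd), topic `Scaling`, FANOUT row 29 (theory-2) — OUR WORK (THEORY-2.md §3.3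
v2.6, "(C2a-Cε) the ε-ROBUST CONTRACTION LAW").  The exact contraction law `ExactTransportContraction`
(`Scaling/ExactTransportOneSided.lean`: `log coLip(T) ≥ c·log β - C` for EXACT co-Lipschitz transports
`T_* Haar^{⊗E} = μ_{Λ,β}`) used exactness through a density bound at ONE small ball.  Here the same rate
`c = q/(2κd)` is obtained for every map that is merely `ε`-ACCURATE in the one-sided sense
`μ_{Λ,β}(B) ≤ (T_*π)(B) + ε` on measurable sets, for any `ε ≤ 1/4` — so it applies to every APPROXIMATE flow that is
useful at all (total-variation error `≤ 1/4`), and it contains the exact law (`exactTransportContraction_of_accurate`).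

* `AccurateTransportContraction d N G ρ` — the statement (`@[conjecture]`-tagged, PROVED below under two-sided Haar
  ball volumes + the tree's Laplace half-mass law; instances `U1./UN./SUN.accurateTransportContraction` with no
  hypothesis left, `d ≥ 2`, `L ≥ 4`, `c = 1/(16d)`).
* MECHANISM (`accurateTransportContraction_of_laplaceHalfMass`) — a PACKING argument that never touches the
  partition function or a density: half of `μ_β` sits on a measurable `E` of prior mass `π(E) ≤ (c₀/β)^{nTr/2}`
  (`Conjectures.LaplaceHalfMass`, PROVED in the tree for `U(1)`, `U(N)`, `SU(N)`); accuracy gives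
  `(T_*π)(E) ≥ 1/2 - ε ≥ 1/4`; inner regularity gives a closed `F ⊆ E` with `(T_*π)(F) > 1/8`; for `r ∈ (0,1)` a
  finite `r`-net of the compact `F` and the VITALI `4r`-covering lemma give `M` centres in `F` with DISJOINT closed
  `r`-balls (so `M·(a r^κ)^{#E} ≤ π(F^{r})`, `F^{r}` the closed `r`-thickening) whose `4r`-balls cover `F`; the
  preimage of a `4r`-ball under a `K'`-co-Lipschitz map has diameter `≤ 8K'r`, so
  `π(T⁻¹F) ≤ M·(A(8K'r)^κ)^{#E}`; the radius CANCELS: `1/8 < π(F^{r})·((A/a)·8^κ·K'^κ)^{#E}` for every `r`, and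
  `r → 0⁺` (`π(F^{r}) → π(F) ≤ π(E)`) yields `1/8 ≤ (c₀/β)^{nTr/2}·((A/a)8^κ K'^κ)^{dL^d}`, i.e. with `nTr ≥ qL^d`:
  `κd·log K' ≥ (q/2)·log β - (q/2)·log c₀ - d·log(A/a) - κd·log 8 - log 8`.
* READING (THEORY-2.md §3.3/§6): the CONTRACTION an (approximate) flow must perform is the ENTROPY side — forced by
  weak-coupling concentration alone, polynomial in `β` per link, uniform in `L`, and indifferent to exactness; the
  EXPANSION law `Lip ≥ e^{cβ}` (`ExactTransportExpansion`) is the exactness artefact.  A.e.-measurability of `T` is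
  not assumed (a non-a.e.-measurable `T` has `T_*π = 0` in Mathlib and then violates accuracy at `B = E`).

Elementary given the tree; nothing here is cited as a fact (the Vitali covering lemma is Mathlib's
`Vitali.exists_disjoint_subfamily_covering_enlargement_closedBall`).
-/

noncomputable section

namespace Summit.Ventures.LatticeQCDFlow.Theory2.Lattice

open MeasureTheory Metric Set Filter Topology Literature.MathematicalPhysics.QuantumFieldTheory

/-! ## §0. The statement -/

section Defs

variable (d N : ℕ) (G : Type) [Group G] [MetricSpace G] [IsTopologicalGroup G] [CompactSpace G]
  [MeasurableSpace G] [BorelSpace G] (ρ : G →* Matrix (Fin N) (Fin N) ℂ)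

/-- **(C2a-Cε) THE ε-ROBUST CONTRACTION LAW** (OURS, THEORY-2.md §3.3 v2.6): there are `c > 0`, `C`, `β₀`, `L₀`
such that for every `L ≥ L₀`, `β ≥ β₀`, `ε ∈ [0, 1/4]` and every `K'`-co-Lipschitz map `T` of `G^E` (sup metric)
with `μ_{Λ,β}(B) ≤ (T_*Haar^{⊗E})(B) + ε` for all measurable `B`: `log K' ≥ c·log β - C`.  Proved below from
the Laplace half-mass law; contains `ExactTransportContraction` (`ε = 0`). [folklore] -/
@[conjecture]
def AccurateTransportContraction : Prop :=
  ∃ c : ℝ, 0 < c ∧ ∃ C β₀ : ℝ, ∃ L₀ : ℕ, ∀ (L : ℕ) [NeZero L], L₀ ≤ L → ∀ β : ℝ, β₀ ≤ β →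
    ∀ ε : ℝ, 0 ≤ ε → ε ≤ 1 / 4 →
    ∀ (T : GaugeConfig d L G → GaugeConfig d L G) (K' : NNReal), AntilipschitzWith K' T →
      (∀ B : Set (GaugeConfig d L G), MeasurableSet B →
        wilsonMeasure (d := d) (L := L) ρ β B ≤
          (Measure.pi fun _ : Edge d L => haarProbability G).map T B + ENNReal.ofReal ε) →
      c * Real.log β - C ≤ Real.log (K' : ℝ)

end Defs

/-! ## §1. The ε-robust law contains the exact law -/

section Laws

variable {N : ℕ} {G : Type} [Group G] [MetricSpace G] [IsTopologicalGroup G] [CompactSpace G]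
  [SecondCountableTopology G] [MeasurableSpace G] [BorelSpace G]
  (ρ : G →* Matrix (Fin N) (Fin N) ℂ)

omit [SecondCountableTopology G] in
/-- `AccurateTransportContraction ⟹ ExactTransportContraction` (take `ε = 0`). [folklore] -/
theorem exactTransportContraction_of_accurate {d : ℕ} (h : AccurateTransportContraction d N G ρ) :
    ExactTransportContraction d N G ρ := by
  obtain ⟨c, hc, C, β₀, L₀, hL⟩ := h
  refine ⟨c, hc, C, β₀, L₀, fun L _ hLL β hβ T K' hT' hmap => ?_⟩
  refine hL L hLL β hβ 0 le_rfl (by norm_num) T K' hT' fun B _ => ?_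
  rw [hmap]
  exact le_self_add

/-! ## §2. The packing proof -/

/-- **(C2a-Cε) PROVED from the Laplace half-mass law** (OURS): two-sided Haar ball volumes with exponent `κ ≥ 1`,
`d ≥ 1`, the tree item `Conjectures.LaplaceHalfMass d N G ρ nTr` and `nTr(L) ≥ q·L^d` (`q > 0`) for `L ≥ L₀`
⟹ `AccurateTransportContraction d N G ρ` with `c = q/(2κd)` (no continuity or trace hypothesis on `ρ` is needed:
the half-mass law carries everything). [folklore] -/
theorem accurateTransportContraction_of_laplaceHalfMass (d : ℕ) (hd : 1 ≤ d)
    {κ : ℕ} (hκ : 0 < κ) {a A : ℝ} (ha : 0 < a)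
    (hlo : ∀ (g : G) (r : ℝ), 0 < r → r ≤ 1 → a * r ^ κ ≤ (haarProbability G (closedBall g r)).toReal)
    (hup : ∀ (g : G) (r : ℝ), 0 < r → (haarProbability G (closedBall g r)).toReal ≤ A * r ^ κ)
    {nTr : ℕ → ℝ} (hLHM : Conjectures.LaplaceHalfMass d N G ρ nTr)
    {q : ℝ} (hq : 0 < q) {L₀ : ℕ} (hnTr : ∀ L : ℕ, L₀ ≤ L → q * (L : ℝ) ^ d ≤ nTr L) :
    AccurateTransportContraction d N G ρ := by
  obtain ⟨c₀, hc₀, β₁, hβ₁, hL⟩ := hLHM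
  have haA : a ≤ A := by
    have h1 := hlo 1 1 one_pos le_rfl
    have h2 := hup 1 1 one_pos
    rw [one_pow, mul_one] at h1 h2
    exact h1.trans h2
  have hA : 0 < A := ha.trans_le haA
  have hAa1 : 1 ≤ A / a := (one_le_div ha).2 haA
  have hlogAa : 0 ≤ Real.log (A / a) := Real.log_nonneg hAa1
  have hκr : (0 : ℝ) < κ := by exact_mod_cast hκ
  have hdr : (1 : ℝ) ≤ d := by exact_mod_cast hd
  have hkd : (0 : ℝ) < κ * d := by positivity
  have hlog8 : 0 < Real.log 8 := Real.log_pos (by norm_num)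
  obtain ⟨g₁, hg₁⟩ := exists_ne_one_of_ballVolumes hκ hA hup
  refine ⟨q / (2 * κ * d), by positivity,
    (q / 2 * Real.log c₀ + Real.log 8 + d * Real.log (A / a) + κ * d * Real.log 8) / (κ * d), max β₁ c₀, L₀,
    fun L _ hLL β hβ ε hε0 hε4 T K' hT' hacc => ?_⟩
  have hββ₁ : β₁ ≤ β := le_trans (le_max_left _ _) hβ
  have hβc₀ : c₀ ≤ β := le_trans (le_max_right _ _) hβ
  have hβpos : 0 < β := lt_of_lt_of_le hβ₁ hββ₁
  have hL1 : (1 : ℝ) ≤ L := by exact_mod_cast (NeZero.one_le : 1 ≤ L)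
  have hLd0 : (0 : ℝ) < (L : ℝ) ^ d := by positivity
  have hLd1 : (1 : ℝ) ≤ (L : ℝ) ^ d := one_le_pow₀ hL1
  set π : Measure (GaugeConfig d L G) := Measure.pi fun _ : Edge d L => haarProbability G with hπ
  set nE : ℕ := Fintype.card (Edge d L) with hnE
  have hEn : nE = L ^ d * d := by simp [hnE, Fintype.card_prod, ZMod.card, Fintype.card_fin]
  have hE : (nE : ℝ) = d * (L : ℝ) ^ d := by rw [hEn]; push_cast; ring
  -- `K' > 0`: two distinct configurations
  have hK'0 : 0 < (K' : ℝ) := by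
    set e₀ : Edge d L := (fun _ => 0, ⟨0, hd⟩) with he₀
    have hne : (fun _ : Edge d L => g₁) ≠ (1 : GaugeConfig d L G) := fun h => hg₁ (by
      have := congr_fun h e₀
      simpa using this)
    have h1 := hT'.le_mul_dist (fun _ : Edge d L => g₁) 1
    have hpos : 0 < dist (fun _ : Edge d L => g₁) (1 : GaugeConfig d L G) := dist_pos.2 hne
    rcases K'.coe_nonneg.eq_or_lt with h | h
    · rw [← h, zero_mul] at h1; linarith
    · exact h
  -- the half-mass set and the accuracy hypothesis on it
  obtain ⟨E, hEm, hμE, hπE⟩ := hL L β hββ₁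
  set ν : Measure (GaugeConfig d L G) := π.map T with hν
  have hνEtop : ν E ≠ ⊤ := measure_ne_top ν E
  have hνE : 1 / 4 ≤ (ν E).toReal := by
    have h1 : (2 : ENNReal)⁻¹ ≤ ν E + ENNReal.ofReal ε := hμE.trans (hacc E hEm)
    have h2 := ENNReal.toReal_mono (ENNReal.add_ne_top.2 ⟨hνEtop, ENNReal.ofReal_ne_top⟩) h1
    rw [ENNReal.toReal_add hνEtop ENNReal.ofReal_ne_top, ENNReal.toReal_ofReal hε0, ENNReal.toReal_inv] at h2
    norm_num at h2
    linarith
  -- hence `T` is a.e.-measurable (else `ν = 0`)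
  have hTm : AEMeasurable T π := by
    by_contra h
    have : ν E = 0 := by rw [hν, Measure.map_of_not_aemeasurable h]; rfl
    rw [this, ENNReal.toReal_zero] at hνE
    linarith
  -- a closed (compact) `F ⊆ E` carrying `ν`-mass `> 1/8`
  obtain ⟨F, hFE, hFc, hFlt⟩ := hEm.exists_isClosed_lt_add hνEtop (ε := ENNReal.ofReal (1 / 8))
    (by rw [ne_eq, ENNReal.ofReal_eq_zero]; norm_num)
  have hνFtop : ν F ≠ ⊤ := measure_ne_top ν F
  have hνF : 1 / 8 < (ν F).toReal := by
    have h2 := ENNReal.toReal_strict_mono (ENNReal.add_ne_top.2 ⟨hνFtop, ENNReal.ofReal_ne_top⟩) hFlt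
    rw [ENNReal.toReal_add hνFtop ENNReal.ofReal_ne_top, ENNReal.toReal_ofReal (by norm_num)] at h2
    linarith
  have hFcpt : IsCompact F := hFc.isCompact
  have hνF' : ν F = π (T ⁻¹' F) := by rw [hν, Measure.map_apply_of_aemeasurable hTm hFc.measurableSet]
  -- the scale-free packing bound: for every `r ∈ (0,1)`, `ν(F) ≤ π(F^r)·Λ`
  set Λ : ℝ := (A / a * (8 * K') ^ κ) ^ nE with hΛ
  have hΛ0 : 0 ≤ Λ := by positivity
  have hkey : ∀ r : ℝ, 0 < r → r < 1 → (ν F).toReal ≤ (π (cthickening r F)).toReal * Λ := by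
    intro r hr0 hr1
    -- finite `r`-net of `F`, then Vitali's disjoint subfamily with `4r`-balls covering
    obtain ⟨t, htF, htfin, hcover⟩ := finite_cover_balls_of_compact hFcpt hr0
    obtain ⟨u, hut, hdisj, hbig⟩ := Vitali.exists_disjoint_subfamily_covering_enlargement_closedBall t
      (fun y : GaugeConfig d L G => y) (fun _ => r) r (fun _ _ => le_rfl) 4 (by norm_num)
    have hufin : u.Finite := htfin.subset hut
    set uF : Finset (GaugeConfig d L G) := hufin.toFinset with huF
    have hmemuF : ∀ b, b ∈ uF ↔ b ∈ u := fun b => by rw [huF, Set.Finite.mem_toFinset]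
    -- (i) `F ⊆ ⋃_{b ∈ uF} B̄(b, 4r)`
    have hFcov : F ⊆ ⋃ b ∈ uF, closedBall b (4 * r) := by
      intro z hz
      obtain ⟨a', ha', hza'⟩ : ∃ a' ∈ t, z ∈ ball a' r := by
        have := hcover hz
        simpa only [mem_iUnion, exists_prop] using this
      obtain ⟨b, hb, hsub⟩ := hbig a' ha'
      have hz' : z ∈ closedBall b (4 * r) := hsub (ball_subset_closedBall hza')
      exact mem_biUnion ((hmemuF b).2 hb) hz'
    -- (ii) disjoint `r`-balls about the centres sit inside `F^r`: `card·(a r^κ)^{nE} ≤ π(F^r)`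
    have hdisjF : (↑uF : Set (GaugeConfig d L G)).PairwiseDisjoint fun b => closedBall b r := by
      rw [huF, Set.Finite.coe_toFinset]; exact hdisj
    have hlow : (uF.card : ℝ) * (a * r ^ κ) ^ nE ≤ (π (cthickening r F)).toReal := by
      have hsub : (⋃ b ∈ uF, closedBall b r) ⊆ cthickening r F := by
        intro z hz
        simp only [mem_iUnion, exists_prop] at hz
        obtain ⟨b, hb, hzb⟩ := hz
        exact closedBall_subset_cthickening (htF (hut ((hmemuF b).1 hb))) r hzb
      have h1 : π (⋃ b ∈ uF, closedBall b r) = ∑ b ∈ uF, π (closedBall b r) :=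
        measure_biUnion_finset hdisjF fun b _ => measurableSet_closedBall
      have h2 : (∑ b ∈ uF, π (closedBall b r)).toReal ≤ (π (cthickening r F)).toReal := by
        rw [← h1]; exact ENNReal.toReal_mono (measure_ne_top _ _) (measure_mono hsub)
      rw [ENNReal.toReal_sum fun b _ => measure_ne_top _ _] at h2
      calc (uF.card : ℝ) * (a * r ^ κ) ^ nE = ∑ b ∈ uF, (a * r ^ κ) ^ nE := by
            rw [Finset.sum_const, nsmul_eq_mul]
        _ ≤ ∑ b ∈ uF, (π (closedBall b r)).toReal :=
            Finset.sum_le_sum fun b _ => pow_le_pi_closedBall ha.le hlo b hr0 hr1.le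
        _ ≤ (π (cthickening r F)).toReal := h2
    -- (iii) preimages of `4r`-balls have diameter `≤ 8K'r`: `ν(F) ≤ card·(A(8K'r)^κ)^{nE}`
    have hpre : ∀ b : GaugeConfig d L G,
        (π (T ⁻¹' closedBall b (4 * r))).toReal ≤ (A * (K' * (8 * r)) ^ κ) ^ nE := by
      intro b
      rcases (T ⁻¹' closedBall b (4 * r)).eq_empty_or_nonempty with h0 | ⟨w, hw⟩
      · rw [h0, measure_empty, ENNReal.toReal_zero]; positivity
      · have hsub : T ⁻¹' closedBall b (4 * r) ⊆ closedBall w (K' * (8 * r)) := by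
          intro v hv
          rw [mem_preimage, mem_closedBall] at hv hw
          rw [mem_closedBall]
          calc dist v w ≤ K' * dist (T v) (T w) := hT'.le_mul_dist v w
            _ ≤ K' * (8 * r) := by
                refine mul_le_mul_of_nonneg_left ?_ K'.coe_nonneg
                calc dist (T v) (T w) ≤ dist (T v) b + dist (T w) b := dist_triangle_right _ _ _
                  _ ≤ 4 * r + 4 * r := add_le_add hv hw
                  _ = 8 * r := by ring
        exact (ENNReal.toReal_mono (measure_ne_top _ _) (measure_mono hsub)).trans
          (pi_closedBall_le_pow hup w (mul_pos hK'0 (by positivity)))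
    have hupp : (ν F).toReal ≤ (uF.card : ℝ) * (A * (K' * (8 * r)) ^ κ) ^ nE := by
      have h1 : T ⁻¹' F ⊆ ⋃ b ∈ uF, T ⁻¹' closedBall b (4 * r) := by
        intro v hv
        have := hFcov hv
        simp only [mem_iUnion, exists_prop] at this
        obtain ⟨b, hb, hvb⟩ := this
        simp only [mem_iUnion, exists_prop, mem_preimage]
        exact ⟨b, hb, hvb⟩
      have h2 : π (T ⁻¹' F) ≤ ∑ b ∈ uF, π (T ⁻¹' closedBall b (4 * r)) :=
        (measure_mono h1).trans (measure_biUnion_finset_le uF _)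
      have h3 := ENNReal.toReal_mono (ENNReal.sum_ne_top.2 fun b _ => measure_ne_top _ _) h2
      rw [ENNReal.toReal_sum fun b _ => measure_ne_top _ _] at h3
      rw [hνF']
      calc (π (T ⁻¹' F)).toReal ≤ ∑ b ∈ uF, (π (T ⁻¹' closedBall b (4 * r))).toReal := h3
        _ ≤ ∑ b ∈ uF, (A * (K' * (8 * r)) ^ κ) ^ nE := Finset.sum_le_sum fun b _ => hpre b
        _ = (uF.card : ℝ) * (A * (K' * (8 * r)) ^ κ) ^ nE := by rw [Finset.sum_const, nsmul_eq_mul]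
    -- (iv) the radius cancels
    have hfac : (A * (K' * (8 * r)) ^ κ) ^ nE = Λ * (a * r ^ κ) ^ nE := by
      rw [hΛ, ← mul_pow]
      congr 1
      field_simp
      ring
    calc (ν F).toReal ≤ (uF.card : ℝ) * (A * (K' * (8 * r)) ^ κ) ^ nE := hupp
      _ = Λ * ((uF.card : ℝ) * (a * r ^ κ) ^ nE) := by rw [hfac]; ring
      _ ≤ Λ * (π (cthickening r F)).toReal := mul_le_mul_of_nonneg_left hlow hΛ0
      _ = (π (cthickening r F)).toReal * Λ := mul_comm _ _
  -- `r → 0⁺`: `ν(F) ≤ π(F)·Λ ≤ π(E)·Λ ≤ (c₀/β)^{nTr/2}·Λ`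
  have htend : Tendsto (fun r : ℝ => (π (cthickening r F)).toReal * Λ) (𝓝[>] 0)
      (𝓝 ((π F).toReal * Λ)) := by
    have h1 : Tendsto (fun r : ℝ => π (cthickening r F)) (𝓝 0) (𝓝 (π F)) :=
      tendsto_measure_cthickening_of_isClosed ⟨1, one_pos, measure_ne_top _ _⟩ hFc
    have h2 := ((ENNReal.tendsto_toReal (measure_ne_top π F)).comp h1).mul_const Λ
    exact h2.mono_left nhdsWithin_le_nhds
  have hlim : (ν F).toReal ≤ (π F).toReal * Λ := by
    refine ge_of_tendsto htend ?_
    filter_upwards [Ioo_mem_nhdsGT (zero_lt_one' ℝ)] with r hr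
    exact hkey r hr.1 hr.2
  have hrpow : 0 ≤ (c₀ / β) ^ (nTr L / 2) := Real.rpow_nonneg (by positivity) _
  have hπEr : (π E).toReal ≤ (c₀ / β) ^ (nTr L / 2) := by
    have h := ENNReal.toReal_mono ENNReal.ofReal_ne_top hπE
    rwa [ENNReal.toReal_ofReal hrpow] at h
  have hπFE : (π F).toReal ≤ (π E).toReal := ENNReal.toReal_mono (measure_ne_top _ _) (measure_mono hFE)
  have hfinal : 1 / 8 < (c₀ / β) ^ (nTr L / 2) * Λ := by
    calc (1 : ℝ) / 8 < (ν F).toReal := hνF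
      _ ≤ (π F).toReal * Λ := hlim
      _ ≤ (c₀ / β) ^ (nTr L / 2) * Λ := mul_le_mul_of_nonneg_right (hπFE.trans hπEr) hΛ0
  -- logarithms
  have hΛpos : 0 < Λ := by positivity
  have hmpos : 0 < (c₀ / β) ^ (nTr L / 2) := Real.rpow_pos_of_pos (by positivity) _
  have hlogs := Real.log_lt_log (by norm_num) hfinal
  rw [Real.log_mul hmpos.ne' hΛpos.ne', Real.log_rpow (by positivity), Real.log_div hc₀.ne' hβpos.ne', hΛ,
    Real.log_pow, Real.log_mul (by positivity) (by positivity), Real.log_pow,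
    Real.log_mul (by norm_num) hK'0.ne', Real.log_div (by norm_num) (by norm_num), Real.log_one, zero_sub, hE]
    at hlogs
  have hlogβ : 0 ≤ Real.log β - Real.log c₀ := by
    rw [sub_nonneg]; exact Real.log_le_log hc₀ hβc₀
  have hq' : q * (L : ℝ) ^ d / 2 * (Real.log β - Real.log c₀) ≤ nTr L / 2 * (Real.log β - Real.log c₀) :=
    mul_le_mul_of_nonneg_right (by linarith [hnTr L hLL]) hlogβ
  have hmain : (L : ℝ) ^ d * (q / 2 * (Real.log β - Real.log c₀) - d * Real.log (A / a) -
      κ * d * Real.log 8 - κ * d * Real.log K' - Real.log 8) ≤ 0 := by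
    have hl : Real.log 8 * 1 ≤ Real.log 8 * (L : ℝ) ^ d := mul_le_mul_of_nonneg_left hLd1 hlog8.le
    nlinarith [hlogs, hq', hl, hLd0, hlogAa, hκr, hdr]
  have hmain' : q / 2 * (Real.log β - Real.log c₀) - d * Real.log (A / a) - κ * d * Real.log 8 -
      κ * d * Real.log K' - Real.log 8 ≤ 0 := by
    refine le_of_not_gt fun hcon => ?_
    have : 0 < (L : ℝ) ^ d * (q / 2 * (Real.log β - Real.log c₀) - d * Real.log (A / a) -
        κ * d * Real.log 8 - κ * d * Real.log K' - Real.log 8) := mul_pos hLd0 hcon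
    linarith
  rw [show q / (2 * κ * d) * Real.log β -
      (q / 2 * Real.log c₀ + Real.log 8 + d * Real.log (A / a) + κ * d * Real.log 8) / (κ * d)
      = (q / 2 * (Real.log β - Real.log c₀) - d * Real.log (A / a) - κ * d * Real.log 8 - Real.log 8) /
        (κ * d) by
    field_simp; ring, div_le_iff₀ hkd]
  linarith

end Laws

/-! ## §3. Instances with no hypothesis left: `U(1)`, `U(N)`, `SU(N)`, `d ≥ 2`, `L ≥ 4`, `c = 1/(16d)` -/

section Instances

open scoped Matrix.Norms.Frobenius
open Literature.MathematicalPhysics.QuantumFieldTheory.UnitaryCayley (𝔾)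
open Literature.MathematicalPhysics.QuantumLattice (u1Rep unitaryFundamentalRep fundamentalRep)

/-- **(C2a-Cε) for `U(1) = Circle`, `d ≥ 2`** (OURS): `log K' ≥ (1/(16d))·log β - C` for every `ε`-accurate
(`ε ≤ 1/4`) `K'`-co-Lipschitz map towards the `U(1)` Wilson law, `L ≥ 4`, `β ≥ β₀`. [folklore] -/
theorem U1.accurateTransportContraction (d : ℕ) (hd : 2 ≤ d) :
    AccurateTransportContraction d 1 Circle u1Rep := by
  obtain ⟨a, ha, hlo⟩ := U1.haar_closedBall_ge'
  obtain ⟨A, _, hup⟩ := U1.haar_closedBall_le'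
  refine accurateTransportContraction_of_laplaceHalfMass u1Rep d (by omega) one_pos ha hlo hup
    (U1.laplaceHalfMass d) (q := 1 / 8) (by norm_num) (L₀ := 4) fun L hL => ?_
  have h := pow_div_eight_le_nTr hd hL
  linarith

/-- **(C2a-Cε) for `U(N)`, `N ≥ 1`, `d ≥ 2`, Hilbert–Schmidt metric** (OURS). [folklore] -/
theorem UN.accurateTransportContraction (d N : ℕ) (hd : 2 ≤ d) (hN : 1 ≤ N) :
    @AccurateTransportContraction d N (𝔾 N) _ Subtype.metricSpace UN.isTopologicalGroup_hs UN.compactSpace_hs _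
      UN.borelSpace_hs (unitaryFundamentalRep (Fin N) ℂ) := by
  obtain ⟨a, ha, hlo⟩ := UN.haar_closedBall_ge (N := N)
  obtain ⟨A, hA, hup⟩ := UN.haar_closedBall_le (N := N)
  have hκ : 0 < N * N := Nat.mul_pos (by omega) (by omega)
  have hq : (0 : ℝ) < (N : ℝ) ^ 2 / 8 := by positivity
  refine @accurateTransportContraction_of_laplaceHalfMass N (𝔾 N) _ Subtype.metricSpace
    UN.isTopologicalGroup_hs UN.compactSpace_hs UN.secondCountable_hs _ UN.borelSpace_hs
    (unitaryFundamentalRep (Fin N) ℂ) d (by omega) (N * N) hκ a A ha hlo (fun g r hr => hup g r hr) _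
    (UN.laplaceHalfMass d N) ((N : ℝ) ^ 2 / 8) hq 4 fun L hL => ?_
  have h := pow_div_eight_le_nTr hd hL
  have hN2 : (0 : ℝ) ≤ (N : ℝ) ^ 2 := sq_nonneg _
  calc (N : ℝ) ^ 2 / 8 * (L : ℝ) ^ d = (N : ℝ) ^ 2 * ((L : ℝ) ^ d / 8) := by ring
    _ ≤ (N : ℝ) ^ 2 * (((d : ℝ) - 1) * (L : ℝ) ^ d * (1 - 3 / L) - 2) := mul_le_mul_of_nonneg_left h hN2

/-- **(C2a-Cε) for `SU(N)`, `N ≥ 2`, `d ≥ 2`, Hilbert–Schmidt metric** (OURS; `SU(3)`, `d = 4` included).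
[folklore] -/
theorem SUN.accurateTransportContraction (d N : ℕ) (hd : 2 ≤ d) (hN : 2 ≤ N) :
    @AccurateTransportContraction d N (Matrix.specialUnitaryGroup (Fin N) ℂ) _ Subtype.metricSpace
      SUN.isTopologicalGroup_hs SUN.compactSpace_hs _ SUN.borelSpace_hs (fundamentalRep (Fin N)) := by
  haveI : NeZero N := ⟨by omega⟩
  obtain ⟨a, ha, hlo⟩ := SUN.haar_closedBall_ge (N := N)
  obtain ⟨A, hA, hup⟩ := SUN.haar_closedBall_le (N := N)
  have hκ : 0 < N * N - 1 := by
    have : 2 * 2 ≤ N * N := Nat.mul_le_mul hN hN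
    omega
  have hq : (0 : ℝ) < ((N : ℝ) ^ 2 - 1) / 8 := by
    have : (2 : ℝ) ≤ N := by exact_mod_cast hN
    have : (4 : ℝ) ≤ (N : ℝ) ^ 2 := by nlinarith
    linarith
  refine @accurateTransportContraction_of_laplaceHalfMass N (Matrix.specialUnitaryGroup (Fin N) ℂ) _
    Subtype.metricSpace SUN.isTopologicalGroup_hs SUN.compactSpace_hs SUN.secondCountable_hs _ SUN.borelSpace_hs
    (fundamentalRep (Fin N)) d (by omega) (N * N - 1) hκ a A ha hlo (fun g r hr => hup g r hr) _
    (SUN.laplaceHalfMass d N (by omega)) (((N : ℝ) ^ 2 - 1) / 8) hq 4 fun L hL => ?_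
  have h := pow_div_eight_le_nTr hd hL
  calc ((N : ℝ) ^ 2 - 1) / 8 * (L : ℝ) ^ d = ((N : ℝ) ^ 2 - 1) * ((L : ℝ) ^ d / 8) := by ring
    _ ≤ ((N : ℝ) ^ 2 - 1) * (((d : ℝ) - 1) * (L : ℝ) ^ d * (1 - 3 / L) - 2) :=
      mul_le_mul_of_nonneg_left h (by linarith)

end Instances

end Summit.Ventures.LatticeQCDFlow.Theory2.Lattice

end
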